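import Literature.NumberTheory.EllipticCurves.BSDSelmerSmithDensityProofs
import Literature.NumberTheory.EllipticCurves.BSDSelmerSmithNormalisationProofs
import Literature.NumberTheory.LFunctions.PrimesInResidueClassReciprocals
import HarnessLib

/-!
# Null sets of twists from a sieve: squarefree `d` with no prime factor in a divergent set of primes

Topic `Literature/NumberTheory/EllipticCurves`, namespace `Literature.NumberTheory.EllipticCurves` (that of
`twistDensity`, file `BSDSelmer`, bsd.S34). Pure-proof file: theorems only, no definition, no named fact.

For the natural density `twistDensity` over squarefree integers ordered by `|d|` (A. Smith,
arXiv:2503.17619, §1) this file proves the elementary sieve statement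

* `twistDensity_zero_forall_prime_not_dvd`: if `P` is a set of primes with `∑_{p ∈ P} 1/p = ∞` (in the
  tree's form `¬ Summable ({p prime, P p}.indicator (1/·))`), then the squarefree `d` divisible by NO prime
  of `P` have density `0`; equivalently (`twistDensity_one_exists_prime_dvd`) `100 %` of the squarefree `d`
  have a prime factor in `P`;

and its instance for primes in an arithmetic progression, from Dirichlet's theorem in reciprocal form
(tree: `Literature.NumberTheory.LFunctions.not_summable_one_div_on_primes_in_residueClass`, Montgomery–Vaughan
Cor. 4.12 (c)):

* `twistDensity_zero_forall_prime_mod_not_dvd` / `twistDensity_one_exists_prime_mod_dvd`: for `k ≥ 1` and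
  `a` coprime to `k`, the squarefree `d` with no prime factor `q ≡ a (mod k)` have density `0`; those with
  such a prime factor have density `1` (also in `ZMod` dress, `…_eq_mod_…`).

Proof (Legendre's sieve, upper bound only). For a finite set `S ⊆ P` of primes with product `Q`, a `d` with
no prime factor in `S` has `gcd(|d|, Q) = 1`; in `[-X, X]` there are at most `2 · #{0 ≤ n ≤ X : (n, Q) = 1}
≤ 2 φ(Q) ((X+1)/Q + 1)` such `d` (Mathlib `Nat.Ico_filter_coprime_le`), while `#{d squarefree, |d| ≤ X} ≥ X/4`
(tree `sqfreeCount_true_ge`); so the upper density is `≤ 16 φ(Q)/Q = 16 ∏_{p ∈ S} (1 − 1/p) ≤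
16 exp(−∑_{p ∈ S} 1/p)`, which is small for `S` a long enough initial segment of `P`.

Use (cell `bsd-goldfeld`, route `GoldfeldAllTwistsTwoConverse`): with the generic-`d` bridge
`GoldfeldGoodTwists.goldfeldAllTwistsX049_of_inputs_offDensityZero` (Theorems file
`GoldfeldAllTwistsX049OffDensityZero`) a line towards the cruxes may ASSUME that the twist parameter `d` has
a prime factor in any prescribed reduced residue class — the habitat of auxiliary-prime arguments.

References: A. Smith, arXiv:2503.17619, §1 (density convention) [arXiv250317619]; H. L. Montgomery,
R. C. Vaughan, *Multiplicative Number Theory I*, CUP 2007, Cor. 4.12 (c) (reciprocals of primes in a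
progression, p. 90) and §3.1 Thm. 3.1 (sieve of Eratosthenes–Legendre) [MontgomeryVaughan2007].
-/

noncomputable section

open scoped Classical

open Filter Topology Finset

namespace Literature.NumberTheory.EllipticCurves

/-! ## §1 The finite sieve: Euler's `φ(Q)/Q` for a squarefree modulus and the window count -/

section FiniteSieve

/-- `φ(∏_{p ∈ S} p) = ∏_{p ∈ S} (p − 1)` for a finite set `S` of primes (multiplicativity of `φ` and
`φ(p) = p − 1`). [folklore] -/
private theorem totient_prod_primes (S : Finset ℕ) (hS : ∀ p ∈ S, p.Prime) :
    Nat.totient (∏ p ∈ S, p) = ∏ p ∈ S, (p - 1) := by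
  induction S using Finset.cons_induction with
  | empty => simp
  | cons p S hpS ih =>
    have hp : p.Prime := hS p (Finset.mem_cons_self p S)
    have hS' : ∀ q ∈ S, q.Prime := fun q hq ↦ hS q (Finset.mem_cons_of_mem hq)
    rw [Finset.prod_cons, Finset.prod_cons, Nat.totient_mul, Nat.totient_prime hp, ih hS']
    exact Nat.coprime_prod_right_iff.2 fun q hq ↦
      (Nat.coprime_primes hp (hS' q hq)).2 fun h ↦ hpS (h ▸ hq)

/-- Euler: `φ(Q)/Q = ∏_{p ∈ S} (1 − 1/p)` for `Q = ∏_{p ∈ S} p`, `S` a finite set of primes. [folklore] -/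
private theorem totient_prod_primes_div (S : Finset ℕ) (hS : ∀ p ∈ S, p.Prime) :
    (Nat.totient (∏ p ∈ S, p) : ℝ) / ((∏ p ∈ S, p : ℕ) : ℝ) = ∏ p ∈ S, (1 - 1 / (p : ℝ)) := by
  rw [totient_prod_primes S hS, Nat.cast_prod, Nat.cast_prod, ← Finset.prod_div_distrib]
  refine Finset.prod_congr rfl fun p hp ↦ ?_
  have hp0 : (p : ℝ) ≠ 0 := by exact_mod_cast (hS p hp).ne_zero
  rw [Nat.cast_sub (hS p hp).one_le, Nat.cast_one, sub_div, div_self hp0]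

/-- `∏_{p ∈ S} (1 − 1/p) ≤ exp(−∑_{p ∈ S} 1/p)` (from `1 − x ≤ e^{−x}`). [folklore] -/
private theorem prod_one_sub_inv_le_exp_neg_sum (S : Finset ℕ) :
    ∏ p ∈ S, (1 - 1 / (p : ℝ)) ≤ Real.exp (-∑ p ∈ S, 1 / (p : ℝ)) := by
  rw [← Finset.sum_neg_distrib, Real.exp_sum]
  refine Finset.prod_le_prod (fun p _ ↦ ?_) fun p _ ↦ ?_
  · have h : 1 / (p : ℝ) ≤ 1 := by
      rcases Nat.eq_zero_or_pos p with h0 | h0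
      · simp [h0]
      · rw [div_le_one (by exact_mod_cast h0)]
        exact_mod_cast h0
    linarith
  · have h := Real.add_one_le_exp (-(1 / (p : ℝ)))
    linarith

/-- In `[-X, X]` at most twice as many integers as in `[0, X]` have `|d|` coprime to `Q` (the map
`d ↦ |d|` is at most two-to-one). [folklore] -/
private theorem card_Icc_filter_coprime_natAbs_le (Q X : ℕ) :
    ((Icc (-(X : ℤ)) X).filter fun d : ℤ ↦ Q.Coprime d.natAbs).card ≤
      2 * ((Ico 0 (0 + (X + 1))).filter fun n ↦ Q.Coprime n).card := by
  set s := (Icc (-(X : ℤ)) X).filter fun d : ℤ ↦ Q.Coprime d.natAbs with hs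
  have h1 : s.card ≤ 2 * (s.image Int.natAbs).card := by
    refine Finset.card_le_mul_card_image s 2 fun b _ ↦ ?_
    calc (s.filter fun d ↦ d.natAbs = b).card ≤ ({(b : ℤ), -(b : ℤ)} : Finset ℤ).card := by
          refine Finset.card_le_card fun d hd ↦ ?_
          rw [Finset.mem_filter] at hd
          rw [Finset.mem_insert, Finset.mem_singleton]
          rcases Int.natAbs_eq d with h | h
          · exact Or.inl (by rw [← hd.2]; exact h)
          · exact Or.inr (by rw [← hd.2]; exact h)
      _ ≤ 2 := Finset.card_le_two
  have h2 : (s.image Int.natAbs).card ≤ ((Ico 0 (0 + (X + 1))).filter fun n ↦ Q.Coprime n).card := by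
    refine Finset.card_le_card fun n hn ↦ ?_
    rw [Finset.mem_image] at hn
    obtain ⟨d, hd, rfl⟩ := hn
    rw [hs, Finset.mem_filter, Finset.mem_Icc] at hd
    rw [Finset.mem_filter, Finset.mem_Ico]
    refine ⟨⟨Nat.zero_le _, ?_⟩, hd.2⟩
    have h : (d.natAbs : ℤ) ≤ X := by rw [Int.natCast_natAbs]; exact abs_le.2 hd.1
    omega
  exact h1.trans (Nat.mul_le_mul_left 2 h2)

/-- **Legendre's sieve, upper bound.** For a finite set `S` of primes with product `Q`, the integers
`|d| ≤ X` with no prime factor in `S` number at most `2 φ(Q) ((X+1)/Q + 1)` (the upper-bound half of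
`S(x, y; P) = (φ(P)/P) y + O(2^{ω(P)})`). [cite: MontgomeryVaughan2007, §3.1 Thm. 3.1 (Eratosthenes–Legendre)] -/
theorem card_Icc_filter_forall_prime_not_dvd_le (S : Finset ℕ) (hS : ∀ p ∈ S, p.Prime) (X : ℕ) :
    ((Icc (-(X : ℤ)) X).filter fun d : ℤ ↦ ∀ p ∈ S, ¬ (p : ℤ) ∣ d).card ≤
      2 * (Nat.totient (∏ p ∈ S, p) * ((X + 1) / (∏ p ∈ S, p) + 1)) := by
  set Q := ∏ p ∈ S, p with hQ
  have hQ0 : Q ≠ 0 := Finset.prod_ne_zero_iff.2 fun p hp ↦ (hS p hp).ne_zero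
  have hsub : ((Icc (-(X : ℤ)) X).filter fun d : ℤ ↦ ∀ p ∈ S, ¬ (p : ℤ) ∣ d) ⊆
      (Icc (-(X : ℤ)) X).filter fun d : ℤ ↦ Q.Coprime d.natAbs := by
    intro d hd
    rw [Finset.mem_filter] at hd ⊢
    refine ⟨hd.1, Nat.coprime_prod_left_iff.2 fun p hp ↦ ?_⟩
    exact (Nat.Prime.coprime_iff_not_dvd (hS p hp)).2 fun h ↦ hd.2 p hp (Int.natCast_dvd.2 h)
  exact (Finset.card_le_card hsub).trans ((card_Icc_filter_coprime_natAbs_le Q X).trans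
    (Nat.mul_le_mul_left 2 (Nat.Ico_filter_coprime_le 0 (X + 1) hQ0)))

/-- **The finite sieve in density form.** For a finite set `S` of primes and `X ≥ 1`, the proportion of
squarefree `|d| ≤ X` with no prime factor in `S` is at most `16 ∏_{p ∈ S} (1 − 1/p) + 8 φ(Q)/X`
(`Q = ∏ S`; window count `≤ 2φ(Q)((X+1)/Q + 1) ≤ 4 X φ(Q)/Q + 2 φ(Q)`, reference count `≥ X/4`).
[cite: MontgomeryVaughan2007, §3.1 Thm. 3.1 (Eratosthenes–Legendre)] -/
theorem density_ratio_forall_prime_not_dvd_le (S : Finset ℕ) (hS : ∀ p ∈ S, p.Prime) {X : ℕ}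
    (hX : 1 ≤ X) :
    (Nat.card {d : ℤ | Squarefree d ∧ |d| ≤ (X : ℤ) ∧ ∀ p ∈ S, ¬ (p : ℤ) ∣ d} : ℝ) /
        Nat.card {d : ℤ | Squarefree d ∧ |d| ≤ (X : ℤ)} ≤
      16 * ∏ p ∈ S, (1 - 1 / (p : ℝ)) + 8 * Nat.totient (∏ p ∈ S, p) / X := by
  set Q := ∏ p ∈ S, p with hQ
  have hQ0 : Q ≠ 0 := Finset.prod_ne_zero_iff.2 fun p hp ↦ (hS p hp).ne_zero
  have hQpos : (0 : ℝ) < Q := by exact_mod_cast Nat.pos_of_ne_zero hQ0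
  have hXpos : (0 : ℝ) < X := by exact_mod_cast hX
  have hφ0 : (0 : ℝ) ≤ Nat.totient Q := Nat.cast_nonneg _
  -- numerator bound
  have hnum : (Nat.card {d : ℤ | Squarefree d ∧ |d| ≤ (X : ℤ) ∧ ∀ p ∈ S, ¬ (p : ℤ) ∣ d} : ℝ) ≤
      4 * X * (Nat.totient Q : ℝ) / Q + 2 * Nat.totient Q := by
    have h1 : Nat.card {d : ℤ | Squarefree d ∧ |d| ≤ (X : ℤ) ∧ ∀ p ∈ S, ¬ (p : ℤ) ∣ d} ≤
        2 * (Nat.totient Q * ((X + 1) / Q + 1)) := by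
      refine le_trans ?_ (card_Icc_filter_forall_prime_not_dvd_le S hS X)
      rw [← Nat.card_eq_finsetCard]
      refine Nat.card_mono (Finset.finite_toSet _) fun d hd ↦ ?_
      simp only [Finset.coe_filter, Finset.mem_Icc, Set.mem_setOf_eq] at hd ⊢
      exact ⟨abs_le.1 hd.2.1, hd.2.2⟩
    have h2 : (((X + 1) / Q : ℕ) : ℝ) ≤ ((X : ℝ) + 1) / Q := by
      have := Nat.cast_div_le (m := X + 1) (n := Q) (α := ℝ)
      push_cast at this
      exact this
    have h3 : ((X : ℝ) + 1) / Q ≤ 2 * X / Q := by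
      refine div_le_div_of_nonneg_right ?_ hQpos.le
      have : (1 : ℝ) ≤ X := by exact_mod_cast hX
      linarith
    calc (Nat.card {d : ℤ | Squarefree d ∧ |d| ≤ (X : ℤ) ∧ ∀ p ∈ S, ¬ (p : ℤ) ∣ d} : ℝ)
        ≤ 2 * (Nat.totient Q * ((((X + 1) / Q : ℕ) : ℝ) + 1)) := by exact_mod_cast h1
      _ ≤ 2 * (Nat.totient Q * (2 * X / Q + 1)) := by gcongr; exact h2.trans h3
      _ = 4 * X * (Nat.totient Q : ℝ) / Q + 2 * Nat.totient Q := by ring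
  -- denominator bound
  have hden : (X : ℝ) / 4 ≤ (Nat.card {d : ℤ | Squarefree d ∧ |d| ≤ (X : ℤ)} : ℝ) := by
    rw [natCard_setOf_squarefree_eq' X]
    exact sqfreeCount_true_ge X
  have hden0 : (0 : ℝ) < (X : ℝ) / 4 := by positivity
  calc (Nat.card {d : ℤ | Squarefree d ∧ |d| ≤ (X : ℤ) ∧ ∀ p ∈ S, ¬ (p : ℤ) ∣ d} : ℝ) /
        Nat.card {d : ℤ | Squarefree d ∧ |d| ≤ (X : ℤ)}
      ≤ (4 * X * (Nat.totient Q : ℝ) / Q + 2 * Nat.totient Q) /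
          Nat.card {d : ℤ | Squarefree d ∧ |d| ≤ (X : ℤ)} :=
        div_le_div_of_nonneg_right hnum (Nat.cast_nonneg _)
    _ ≤ (4 * X * (Nat.totient Q : ℝ) / Q + 2 * Nat.totient Q) / ((X : ℝ) / 4) :=
        div_le_div_of_nonneg_left (by positivity) hden0 hden
    _ = 16 * ((Nat.totient Q : ℝ) / Q) + 8 * Nat.totient Q / X := by
        field_simp
        ring
    _ = 16 * ∏ p ∈ S, (1 - 1 / (p : ℝ)) + 8 * Nat.totient Q / X := by
        rw [hQ, totient_prod_primes_div S hS]

end FiniteSieve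

/-! ## §2 Divergent sets of primes sift out a density-one set of twists -/

section Divergent

variable {P : ℕ → Prop}

/-- From `∑_{p prime, P p} 1/p = ∞`: for every bound `M` some finite set `S` of primes in `P` has
`∑_{p ∈ S} 1/p ≥ M` (partial sums of a divergent series of nonnegative terms are unbounded). [folklore] -/
private theorem exists_finset_primes_sum_inv_ge
    (hP : ¬ Summable (Set.indicator {p : ℕ | p.Prime ∧ P p} fun n ↦ (1 : ℝ) / n)) (M : ℝ) :
    ∃ S : Finset ℕ, (∀ p ∈ S, p.Prime ∧ P p) ∧ M ≤ ∑ p ∈ S, 1 / (p : ℝ) := by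
  have hnn : ∀ n : ℕ, 0 ≤ Set.indicator {p : ℕ | p.Prime ∧ P p} (fun n ↦ (1 : ℝ) / n) n :=
    fun n ↦ Set.indicator_nonneg (fun m _ ↦ by positivity) n
  have ht := (not_summable_iff_tendsto_nat_atTop_of_nonneg hnn).1 hP
  obtain ⟨N, hN⟩ := (tendsto_atTop.1 ht M).exists
  refine ⟨(Finset.range N).filter fun p ↦ p.Prime ∧ P p, fun p hp ↦ (Finset.mem_filter.1 hp).2, ?_⟩
  rw [Finset.sum_filter]
  refine hN.trans (le_of_eq (Finset.sum_congr rfl fun n _ ↦ ?_))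
  rw [Set.indicator_apply]
  rfl

/-- **Squarefree integers with no prime factor in a divergent set of primes are negligible.** Let `P` be a
set of primes with `∑_{p ∈ P} 1/p = ∞` (`hP`, the tree's `¬ Summable (indicator …)` form). Then the
squarefree `d` divisible by no prime `p ∈ P` have natural density `0` (`twistDensity … 0`): by the finite
sieve (`density_ratio_forall_prime_not_dvd_le`) their upper density is `≤ 16 ∏_{p ∈ S}(1 − 1/p) ≤
16 exp(−∑_{p ∈ S} 1/p)` for every finite `S ⊆ P`, which is arbitrarily small (the qualitative content of
Mertens' product form `∏_{p ≤ x, p ∈ P}(1 − 1/p) → 0`, cf. Cor. 4.12 (d) for progressions).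
[cite: MontgomeryVaughan2007, §3.1 Thm. 3.1 and Cor. 4.12 (c)–(d) (p. 90)] -/
theorem twistDensity_zero_forall_prime_not_dvd
    (hP : ¬ Summable (Set.indicator {p : ℕ | p.Prime ∧ P p} fun n ↦ (1 : ℝ) / n)) :
    twistDensity (fun d : ℤ ↦ ∀ p : ℕ, p.Prime → P p → ¬ (p : ℤ) ∣ d) 0 := by
  unfold twistDensity
  set f : ℕ → ℝ := fun X ↦ (Nat.card {d : ℤ | Squarefree d ∧ |d| ≤ (X : ℤ) ∧
    ∀ p : ℕ, p.Prime → P p → ¬ (p : ℤ) ∣ d} : ℝ) / Nat.card {d : ℤ | Squarefree d ∧ |d| ≤ (X : ℤ)}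
    with hf
  have hf0 : ∀ X, 0 ≤ f X := fun X ↦ div_nonneg (Nat.cast_nonneg _) (Nat.cast_nonneg _)
  refine Metric.tendsto_atTop.2 fun ε hε ↦ ?_
  -- a finite `S ⊆ P` with `16 exp(-Σ_S 1/p) < ε/2`
  obtain ⟨S, hSP, hSM⟩ := exists_finset_primes_sum_inv_ge hP (-Real.log (ε / 32) + 1)
  have hS : ∀ p ∈ S, p.Prime := fun p hp ↦ (hSP p hp).1
  have hprod : 16 * ∏ p ∈ S, (1 - 1 / (p : ℝ)) < ε / 2 := by
    have h1 := prod_one_sub_inv_le_exp_neg_sum S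
    have h2 : Real.exp (-∑ p ∈ S, 1 / (p : ℝ)) < ε / 32 := by
      rw [← Real.lt_log_iff_exp_lt (by positivity)]
      linarith
    linarith
  -- the bound of the finite sieve, eventually `< ε`
  set Q := ∏ p ∈ S, p with hQ
  obtain ⟨X₀, hX₀⟩ := exists_nat_gt (16 * (Nat.totient Q : ℝ) / ε)
  refine ⟨max 1 X₀, fun X hX ↦ ?_⟩
  have hX1 : 1 ≤ X := le_of_max_le_left hX
  have hXX₀ : X₀ ≤ X := le_of_max_le_right hX
  have hXpos : (0 : ℝ) < X := by exact_mod_cast hX1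
  rw [Real.dist_eq, sub_zero, abs_of_nonneg (hf0 X)]
  have hmono : f X ≤ (Nat.card {d : ℤ | Squarefree d ∧ |d| ≤ (X : ℤ) ∧ ∀ p ∈ S, ¬ (p : ℤ) ∣ d} : ℝ) /
      Nat.card {d : ℤ | Squarefree d ∧ |d| ≤ (X : ℤ)} := by
    refine div_le_div_of_nonneg_right ?_ (Nat.cast_nonneg _)
    exact_mod_cast Nat.card_mono (finite_setOf_squarefree_abs_le X _)
      fun d (hd : d ∈ {d : ℤ | Squarefree d ∧ |d| ≤ (X : ℤ) ∧ ∀ p : ℕ, p.Prime → P p → ¬ (p : ℤ) ∣ d}) ↦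
        ⟨hd.1, hd.2.1, fun p hp ↦ hd.2.2 p (hSP p hp).1 (hSP p hp).2⟩
  have htail : 8 * (Nat.totient Q : ℝ) / X < ε / 2 := by
    have hX₀' : 16 * (Nat.totient Q : ℝ) / ε < X := hX₀.trans_le (by exact_mod_cast hXX₀)
    rw [div_lt_iff₀ hε] at hX₀'
    rw [div_lt_iff₀ hXpos]
    linarith
  calc f X ≤ _ := hmono
    _ ≤ 16 * ∏ p ∈ S, (1 - 1 / (p : ℝ)) + 8 * Nat.totient (∏ p ∈ S, p) / X :=
        density_ratio_forall_prime_not_dvd_le S hS hX1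
    _ < ε / 2 + ε / 2 := add_lt_add hprod htail
    _ = ε := add_halves ε

/-- **`100 %` of the squarefree `d` have a prime factor in `P`** whenever `∑_{p ∈ P} 1/p = ∞`
(complement of `twistDensity_zero_forall_prime_not_dvd`). [cite: MontgomeryVaughan2007, §3.1 Thm. 3.1 and Cor. 4.12 (c)–(d) (p. 90)] -/
theorem twistDensity_one_exists_prime_dvd
    (hP : ¬ Summable (Set.indicator {p : ℕ | p.Prime ∧ P p} fun n ↦ (1 : ℝ) / n)) :
    twistDensity (fun d : ℤ ↦ ∃ p : ℕ, p.Prime ∧ P p ∧ (p : ℤ) ∣ d) 1 := by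
  have h := (twistDensity_zero_forall_prime_not_dvd hP).compl
  rw [sub_zero] at h
  refine (twistDensity_congr (fun d _ ↦ ?_) 1).1 h
  simp only [not_forall, not_not, exists_prop]

end Divergent

/-! ## §3 Primes in an arithmetic progression (Dirichlet, reciprocal form) -/

section Progressions

/-- **No prime factor in a reduced residue class: a null set of twists.** For `k ≥ 1` and `a` coprime to
`k`, the squarefree `d` with no prime factor `q ≡ a (mod k)` have natural density `0` — the sieve
`twistDensity_zero_forall_prime_not_dvd` fed with Dirichlet's theorem in reciprocal form
(`LFunctions.not_summable_one_div_on_primes_in_residueClass`). [cite: MontgomeryVaughan2007, Cor. 4.12 (c)–(d) (p. 90) and §3.1 Thm. 3.1] -/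
theorem twistDensity_zero_forall_prime_mod_not_dvd (k a : ℕ) (hk : 0 < k) (hak : Nat.Coprime a k) :
    twistDensity (fun d : ℤ ↦ ∀ q : ℕ, q.Prime → q % k = a % k → ¬ (q : ℤ) ∣ d) 0 :=
  twistDensity_zero_forall_prime_not_dvd (P := fun q ↦ q % k = a % k)
    (LFunctions.not_summable_one_div_on_primes_in_residueClass k a hk hak)

/-- **`100 %` of the squarefree `d` have a prime factor `q ≡ a (mod k)`** (`k ≥ 1`, `(a, k) = 1`).
[cite: MontgomeryVaughan2007, Cor. 4.12 (c)–(d) (p. 90) and §3.1 Thm. 3.1] -/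
theorem twistDensity_one_exists_prime_mod_dvd (k a : ℕ) (hk : 0 < k) (hak : Nat.Coprime a k) :
    twistDensity (fun d : ℤ ↦ ∃ q : ℕ, q.Prime ∧ q % k = a % k ∧ (q : ℤ) ∣ d) 1 :=
  twistDensity_one_exists_prime_dvd (P := fun q ↦ q % k = a % k)
    (LFunctions.not_summable_one_div_on_primes_in_residueClass k a hk hak)

/-- The same in `ZMod` dress: for `q ≥ 1` and a unit `a : ZMod q`, the squarefree `d` with no prime factor
`ℓ` with `(ℓ : ZMod q) = a` have density `0`. [cite: MontgomeryVaughan2007, Cor. 4.12 (c)–(d) (p. 90) and §3.1 Thm. 3.1] -/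
theorem twistDensity_zero_forall_prime_eq_mod_not_dvd {q : ℕ} [NeZero q] {a : ZMod q} (ha : IsUnit a) :
    twistDensity (fun d : ℤ ↦ ∀ ℓ : ℕ, ℓ.Prime → (ℓ : ZMod q) = a → ¬ (ℓ : ℤ) ∣ d) 0 :=
  twistDensity_zero_forall_prime_not_dvd (P := fun ℓ ↦ (ℓ : ZMod q) = a)
    (LFunctions.not_summable_one_div_on_primes_eq_mod ha)

/-- `ZMod` dress, density-one form: `100 %` of the squarefree `d` have a prime factor `ℓ` with
`(ℓ : ZMod q) = a` (`a` a unit). [cite: MontgomeryVaughan2007, Cor. 4.12 (c)–(d) (p. 90) and §3.1 Thm. 3.1] -/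
theorem twistDensity_one_exists_prime_eq_mod_dvd {q : ℕ} [NeZero q] {a : ZMod q} (ha : IsUnit a) :
    twistDensity (fun d : ℤ ↦ ∃ ℓ : ℕ, ℓ.Prime ∧ (ℓ : ZMod q) = a ∧ (ℓ : ℤ) ∣ d) 1 :=
  twistDensity_one_exists_prime_dvd (P := fun ℓ ↦ (ℓ : ZMod q) = a)
    (LFunctions.not_summable_one_div_on_primes_eq_mod ha)

end Progressions

end Literature.NumberTheory.EllipticCurves

end
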